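import Summits.AtomisticToContinuum.BoseEinsteinCondensation.Theorems.BoxCountShadowCoercivityLine
import HarnessLib

/-!
# BoxCountShadowDisplacementTyp — the residual DISP_h reduced to TYPICAL fibres (a DISP-facing by-product of COERC_h)

With the truncated density law of large numbers DLT_h a THEOREM (`CoercivityLine.densityLLNTrunc_holds`), the pairs
`(B, j)` whose conditioning count `j = m_B(Y)` is ATYPICAL — `j + 1 < λ/2` or `j > 2λ`, `λ = N/K³` — carry total pair
weight `≤ 4 · countVarianceTrunc` (`pairWeightOn_atypical_le`; no symmetry or normalisation needed: whatever the
position of the tagged particle, the full count `N_B ∈ {j, j+1}` has `4·min((N_B/λ − 1)², 1) ≥ 1`), hence are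
provably exceptional.  Consequently the residual of record's door input DISP_h = `GroundStateHorizonDisplacement η`
follows from its TYPICAL-FIBRE form `GroundStateHorizonDisplacementTyp η` (displacement quasi-invariance demanded only
on fibres with `λ/2 ≤ j + 1` and `j ≤ 2λ`, exceptional weight `≤ 1/8`): `horizonDisplacement_of_typ'`, and so do
MARG_h (`horizonCellCountAffinity_of_typ`) and the kernel (`bec_of_displacementTyp`).  The near-jammed fibres named in
DISP_h's «why it might fail» are thereby removed from the residual.  No instances, no notation, no sorry.
-/

noncomputable section

open MeasureTheory Filter Set
open scoped ENNReal NNReal BigOperators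

namespace Summit.AtomisticToContinuum.BoseEinsteinCondensation.Theorems.BoxCountShadow

open Literature.MathematicalPhysics.QuantumManyBody.BoseGas
open Summit.AtomisticToContinuum.BoseEinsteinCondensation.Theorems.BoxLatticeFSum
open Summit.AtomisticToContinuum.BoseEinsteinCondensation.Theorems.BoxLabelAffinity
open Summit.AtomisticToContinuum.BoseEinsteinCondensation.Theorems.BoxHorizonAffinity

variable {n : ℕ}

/-! ### Typical pairs and the atypical weight -/

/-- The TYPICAL pairs `(B, j)`: conditioning counts with `λ/2 ≤ j + 1` and `j ≤ 2λ`. [folklore] -/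
def typicalPairs (lam : ℝ) (K : ℕ) : Set (SubIdx K × ℕ) :=
  {p | lam / 2 ≤ (p.2 : ℝ) + 1 ∧ (p.2 : ℝ) ≤ 2 * lam}

/-- On an atypical fibre the truncated Chebyshev weight of the FULL count is `≥ 1/4`, whatever the tagged particle
does (`N' ∈ {j, j+1}`). [folklore] -/
theorem one_le_four_mul_trunc_of_atypical {lam : ℝ} (hlam : 0 < lam) {j N' : ℕ}
    (hj : ¬ (lam / 2 ≤ (j : ℝ) + 1 ∧ (j : ℝ) ≤ 2 * lam)) (h1 : j ≤ N') (h2 : N' ≤ j + 1) :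
    (1 : ℝ≥0∞) ≤ 4 * ENNReal.ofReal (min (((N' : ℝ) / lam - 1) ^ 2) 1) := by
  have hq : (1 / 4 : ℝ) ≤ min (((N' : ℝ) / lam - 1) ^ 2) 1 := by
    rcases not_and_or.1 hj with h | h
    · have h2r : (N' : ℝ) ≤ (j : ℝ) + 1 := by exact_mod_cast h2
      have hN : (N' : ℝ) / lam < 1 / 2 := by
        rw [div_lt_iff₀ hlam]; linarith [not_le.1 h]
      refine le_min ?_ (by norm_num)
      calc (1 / 4 : ℝ) = (1 / 2) ^ 2 := by norm_num
        _ ≤ (1 - (N' : ℝ) / lam) ^ 2 := pow_le_pow_left₀ (by norm_num) (by linarith) 2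
        _ = ((N' : ℝ) / lam - 1) ^ 2 := by ring
    · have h1r : (j : ℝ) ≤ (N' : ℝ) := by exact_mod_cast h1
      have hN : 2 < (N' : ℝ) / lam := by
        rw [lt_div_iff₀ hlam]; linarith [not_le.1 h]
      refine le_min ?_ (by norm_num)
      calc (1 / 4 : ℝ) ≤ 1 ^ 2 := by norm_num
        _ ≤ ((N' : ℝ) / lam - 1) ^ 2 := pow_le_pow_left₀ (by norm_num) (by linarith) 2
  calc (1 : ℝ≥0∞) = 4 * ENNReal.ofReal (1 / 4) := by
        rw [ENNReal.ofReal_div_of_pos (by norm_num : (0:ℝ) < 4), ENNReal.ofReal_one,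
          ENNReal.ofReal_ofNat, ENNReal.mul_div_cancel (by norm_num) ENNReal.ofNat_ne_top]
    _ ≤ 4 * ENNReal.ofReal (min (((N' : ℝ) / lam - 1) ^ 2) 1) := by
        gcongr

/-- **Tagged fibre vs full count, without correction**: if every `j ∈ D` has `4·min((N'/λ − 1)², 1) ≥ 1` for both
`N' = j` and `N' = j + 1`, then `∫_{m_B(Y) ∈ D} P̂(Y) dY ≤ 4 ∫ min((N_B(X)/λ − 1)², 1) Φ(X)² dX`. [folklore] -/
theorem fibre_sliceSq_le_trunc {L : ℝ} {K : ℕ} {Φ : Config (n + 1) → ℝ} (hΦm : Measurable Φ) {lam : ℝ}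
    (B : SubIdx K) (D : Set ℕ)
    (hD : ∀ j ∈ D, ∀ N' : ℕ, j ≤ N' → N' ≤ j + 1 →
      (1 : ℝ≥0∞) ≤ 4 * ENNReal.ofReal (min (((N' : ℝ) / lam - 1) ^ 2) 1)) :
    ∫⁻ Y in ((fun m : SubIdx K → ℕ => m B) ∘ countVec (L / (K : ℝ)) K) ⁻¹' D, sliceSq Φ Y ≤
      4 * ∫⁻ X : Config (n + 1),
        ENNReal.ofReal (min ((((countVec (L / (K : ℝ)) K X B : ℕ) : ℝ) / lam - 1) ^ 2) 1) *
          ENNReal.ofReal (Φ X) ^ 2 := by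
  set ℓ := L / (K : ℝ) with hℓdef
  have hT : Measurable ((fun m : SubIdx K → ℕ => m B) ∘ countVec (n := n) ℓ K) :=
    (measurable_pi_apply B).comp (measurable_countVec ℓ K)
  have hfib : MeasurableSet (((fun m : SubIdx K → ℕ => m B) ∘ countVec (n := n) ℓ K) ⁻¹' D) :=
    hT MeasurableSet.of_discrete
  have hV : Measurable fun X : Config (n + 1) =>
      ENNReal.ofReal (min ((((countVec ℓ K X B : ℕ) : ℝ) / lam - 1) ^ 2) 1) * ENNReal.ofReal (Φ X) ^ 2 :=
    measurable_varTermTrunc B lam hΦm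
  rw [← lintegral_indicator hfib, ← lintegral_const_mul _ hV,
    lintegral_eq_lintegral_lintegral_vecCons (hV.const_mul _)]
  refine lintegral_mono fun Y => ?_
  by_cases hY : Y ∈ ((fun m : SubIdx K → ℕ => m B) ∘ countVec ℓ K) ⁻¹' D
  · rw [Set.indicator_of_mem hY]
    unfold sliceSq
    refine lintegral_mono fun x => ?_
    have hj : countVec ℓ K Y B ∈ D := hY
    have hcnt : countVec ℓ K (Matrix.vecCons x Y : Config (n + 1)) B =
        (subCell ℓ B).indicator (fun _ => (1 : ℕ)) x + countVec ℓ K Y B := countVec_vecCons ℓ K x Y B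
    have hb : (subCell ℓ B).indicator (fun _ => (1 : ℕ)) x ≤ 1 := by
      by_cases hx : x ∈ subCell ℓ B
      · rw [Set.indicator_of_mem hx]
      · rw [Set.indicator_of_notMem hx]; exact zero_le_one
    have hlo : countVec ℓ K Y B ≤ countVec ℓ K (Matrix.vecCons x Y : Config (n + 1)) B := by
      rw [hcnt]; exact le_add_self
    have hhi : countVec ℓ K (Matrix.vecCons x Y : Config (n + 1)) B ≤ countVec ℓ K Y B + 1 := by
      rw [hcnt]; omega
    have h1 := hD _ hj _ hlo hhi
    calc ENNReal.ofReal (Φ (Matrix.vecCons x Y)) ^ 2 = 1 * ENNReal.ofReal (Φ (Matrix.vecCons x Y)) ^ 2 :=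
          (one_mul _).symm
      _ ≤ (4 * ENNReal.ofReal (min ((((countVec ℓ K (Matrix.vecCons x Y : Config (n + 1)) B : ℕ) : ℝ) /
              lam - 1) ^ 2) 1)) * ENNReal.ofReal (Φ (Matrix.vecCons x Y)) ^ 2 := mul_le_mul' h1 le_rfl
      _ = _ := by rw [mul_assoc]
  · rw [Set.indicator_of_notMem hY]
    exact bot_le

/-- **The atypical pairs are exceptional**: `pairWeightOn L K Φ (typicalPairs λ K)ᶜ ≤ 4 · countVarianceTrunc L K Φ`
(`λ = N/K³`), for every measurable amplitude. [folklore] -/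
theorem pairWeightOn_atypical_le {L : ℝ} {K : ℕ} (hK : 0 < K) {Φ : Config (n + 1) → ℝ} (hΦm : Measurable Φ) :
    pairWeightOn L K Φ (typicalPairs (((n + 1 : ℕ) : ℝ) / (K : ℝ) ^ 3) K)ᶜ ≤ 4 * countVarianceTrunc L K Φ := by
  have hKr : (0 : ℝ) < K := by exact_mod_cast hK
  set lam : ℝ := ((n + 1 : ℕ) : ℝ) / (K : ℝ) ^ 3 with hlamdef
  have hlam : 0 < lam := by positivity
  set D : Set (SubIdx K × ℕ) := (typicalPairs lam K)ᶜ with hDdef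
  set Dc : SubIdx K → Set ℕ := fun B => {j | (B, j) ∈ D} with hDcdef
  have hT : ∀ B, Measurable ((fun m : SubIdx K → ℕ => m B) ∘ countVec (n := n) (L / (K : ℝ)) K) := fun B =>
    (measurable_pi_apply B).comp (measurable_countVec (L / (K : ℝ)) K)
  set V : SubIdx K → ℝ≥0∞ := fun B => ∫⁻ X : Config (n + 1),
    ENNReal.ofReal (min ((((countVec (L / (K : ℝ)) K X B : ℕ) : ℝ) / lam - 1) ^ 2) 1) *
      ENNReal.ofReal (Φ X) ^ 2 with hVdef
  have hCV : countVarianceTrunc L K Φ = ∑ B, blockWeight K ^ 2 * V B := rfl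
  -- Step 1: the weight as tagged fibre integrals
  have h1 : pairWeightOn L K Φ D = ∑ B, blockWeight K ^ 2 *
      ∫⁻ Y in ((fun m : SubIdx K → ℕ => m B) ∘ countVec (L / (K : ℝ)) K) ⁻¹' (Dc B), sliceSq Φ Y := by
    unfold pairWeightOn
    refine Finset.sum_congr rfl fun B _ => ?_
    rw [← tsum_indicator_fibre volume (hT B) (sliceSq Φ) (Dc B), ← ENNReal.tsum_mul_left]
    refine tsum_congr fun j => ?_
    by_cases hj : (B, j) ∈ D
    · have hj' : j ∈ Dc B := hj
      rw [Set.indicator_of_mem hj, Set.indicator_of_mem hj']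
      rfl
    · have hj' : j ∉ Dc B := hj
      rw [Set.indicator_of_notMem hj, Set.indicator_of_notMem hj', mul_zero]
  -- Step 2: each fibre integral is at most `4 V_B`
  have h2 : ∀ B, ∫⁻ Y in ((fun m : SubIdx K → ℕ => m B) ∘ countVec (L / (K : ℝ)) K) ⁻¹' (Dc B), sliceSq Φ Y ≤
      4 * V B := by
    intro B
    refine fibre_sliceSq_le_trunc hΦm B (Dc B) fun j hj N' hlo hhi => ?_
    have hj' : ¬ (lam / 2 ≤ (j : ℝ) + 1 ∧ (j : ℝ) ≤ 2 * lam) := hj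
    exact one_le_four_mul_trunc_of_atypical hlam hj' hlo hhi
  rw [h1]
  calc ∑ B, blockWeight K ^ 2 *
          ∫⁻ Y in ((fun m : SubIdx K → ℕ => m B) ∘ countVec (L / (K : ℝ)) K) ⁻¹' (Dc B), sliceSq Φ Y
      ≤ ∑ B, blockWeight K ^ 2 * (4 * V B) := Finset.sum_le_sum fun B _ => mul_le_mul' le_rfl (h2 B)
    _ = 4 * countVarianceTrunc L K Φ := by
        rw [hCV, Finset.mul_sum]
        refine Finset.sum_congr rfl fun B _ => ?_
        ring

/-! ### The typical-fibre form of DISP_h and the doors -/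

/-- **DISP_h^typ(η)** (TYPICAL-FIBRE form of the residual's displacement input · NON-ENERGY · UNDECIDED ·
IDEA-NEEDED): as `GroundStateHorizonDisplacement η`, but the one-coordinate displacement quasi-invariance
`κ₁ · Q_{B→B'}(j) ≤ P_B(j)` is demanded ONLY on fibres with typical conditioning count (`λ/2 ≤ j + 1`, `j ≤ 2λ`,
`λ = N/K³`), with exceptional weight `≤ 1/8`.  With DLT_h a theorem it implies DISP_h (`horizonDisplacement_of_typ'`).
Why it might fail: as DISP_h, minus the near-jammed fibres. [cite: LSSY2005, Thm 7.1] -/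
@[conjecture] def GroundStateHorizonDisplacementTyp (η : ℝ≥0) : Prop :=
  ∀ v : ℝ → ℝ≥0∞, IsRepulsiveFiniteRange v → 0 < scatteringLength v →
    ∃ M₀ : ℝ, 0 < M₀ ∧ ∀ M : ℝ, M₀ ≤ M → ∃ κ₁ : ℝ, 0 < κ₁ ∧ ∃ ρ₀ : ℝ, 0 < ρ₀ ∧
      ∀ ρ : ℝ, 0 < ρ → ρ < ρ₀ → ∀ᶠ n : ℕ in atTop,
        (∃ Ψ₀ : Config (n + 1) → ℝ, (∀ X, 0 ≤ Ψ₀ X) ∧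
          IsGroundState v (sideLength ρ (n + 1)) (fun X => (Ψ₀ X : ℂ))) →
        ∀ K : ℕ, 0 < K → InWindow (M * ρ ^ (-(η : ℝ))) ρ (sideLength ρ (n + 1)) K →
          ∃ G₁ : Set (SubIdx K × ℕ),
            pairWeightOn (sideLength ρ (n + 1)) K (groundState v (n + 1) (sideLength ρ (n + 1))) G₁ᶜ ≤ 1 / 8 ∧
              ∀ (B : SubIdx K) (j : ℕ), (B, j) ∈ G₁ →
                ((n + 1 : ℕ) : ℝ) / (K : ℝ) ^ 3 / 2 ≤ (j : ℝ) + 1 →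
                (j : ℝ) ≤ 2 * (((n + 1 : ℕ) : ℝ) / (K : ℝ) ^ 3) →
                ∀ B' ∈ nbrs B,
                  ENNReal.ofReal κ₁ *
                      cellPairMass (sideLength ρ (n + 1)) K (groundState v (n + 1) (sideLength ρ (n + 1))) B B' j ≤
                    cellMass (sideLength ρ (n + 1)) K (groundState v (n + 1) (sideLength ρ (n + 1))) B j

/-- **DLT_h ∧ DISP_h^typ ⟹ DISP_h** (`G₁ := G₁^typ ∩ typicalPairs`, DLT_h at `s = 1/32`:
`1/8 + 4/32 = 1/4`). [folklore] -/
theorem horizonDisplacement_of_typ (η : ℝ≥0) (hdlt : GroundStateHorizonDensityLLNTrunc η)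
    (htyp : GroundStateHorizonDisplacementTyp η) : GroundStateHorizonDisplacement η := by
  intro v hv ha
  obtain ⟨M₀, hM₀, h⟩ := htyp v hv ha
  refine ⟨M₀, hM₀, fun M hM => ?_⟩
  have hMpos : 0 < M := hM₀.trans_le hM
  obtain ⟨κ₁, hκ₁, ρ₁, hρ₁, h₁⟩ := h M hM
  obtain ⟨ρ₂, hρ₂, h₂⟩ := hdlt v hv ha (1 / 32) (by norm_num) M hMpos
  refine ⟨κ₁, hκ₁, min ρ₁ ρ₂, lt_min hρ₁ hρ₂, fun ρ hρ hρlt => ?_⟩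
  filter_upwards [h₁ ρ hρ (hρlt.trans_le (min_le_left _ _)),
    h₂ ρ hρ (hρlt.trans_le (min_le_right _ _))] with n hn₁ hn₂ hex K hK hKw
  set L := sideLength ρ (n + 1) with hLdef
  set Φ := groundState v (n + 1) L with hΦdef
  have hΦm : Measurable Φ := measurable_groundState v (n + 1) L
  obtain ⟨G₁, hG₁, hD⟩ := hn₁ hex K hK hKw
  have hCV : countVarianceTrunc L K Φ ≤ ENNReal.ofReal (1 / 32) := hn₂ hex K hK hKw
  set lam : ℝ := ((n + 1 : ℕ) : ℝ) / (K : ℝ) ^ 3 with hlamdef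
  refine ⟨G₁ ∩ typicalPairs lam K, ?_, ?_⟩
  · have e1 : (4 : ℝ≥0∞) * ENNReal.ofReal (1 / 32) = ENNReal.ofReal (1 / 8) := by
      rw [show (1 / 8 : ℝ) = 4 * (1 / 32) by norm_num, ENNReal.ofReal_mul (by norm_num : (0 : ℝ) ≤ 4),
        ENNReal.ofReal_ofNat]
    have e8 : (1 / 8 : ℝ≥0∞) = ENNReal.ofReal (1 / 8) := by
      rw [ENNReal.ofReal_div_of_pos (by norm_num : (0 : ℝ) < 8), ENNReal.ofReal_one, ENNReal.ofReal_ofNat]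
    have e4 : (1 / 4 : ℝ≥0∞) = ENNReal.ofReal (1 / 4) := by
      rw [ENNReal.ofReal_div_of_pos (by norm_num : (0 : ℝ) < 4), ENNReal.ofReal_one, ENNReal.ofReal_ofNat]
    calc pairWeightOn L K Φ (G₁ ∩ typicalPairs lam K)ᶜ
        ≤ pairWeightOn L K Φ G₁ᶜ + pairWeightOn L K Φ (typicalPairs lam K)ᶜ :=
          pairWeightOn_compl_inter_le L K Φ _ _
      _ ≤ 1 / 8 + 4 * countVarianceTrunc L K Φ := add_le_add hG₁ (pairWeightOn_atypical_le hK hΦm)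
      _ ≤ 1 / 8 + 4 * ENNReal.ofReal (1 / 32) := by gcongr
      _ = 1 / 4 := by
          rw [e1, e8, e4, ← ENNReal.ofReal_add (by norm_num) (by norm_num)]
          norm_num
  · intro B j hp B' hB'
    exact hD B j hp.1 hp.2.1 hp.2.2 B' hB'

/-- **DISP_h^typ ⟹ DISP_h** unconditionally (DLT_h is the theorem `CoercivityLine.densityLLNTrunc_holds`). [folklore] -/
theorem horizonDisplacement_of_typ' (η : ℝ≥0) (htyp : GroundStateHorizonDisplacementTyp η) :
    GroundStateHorizonDisplacement η :=
  horizonDisplacement_of_typ η (CoercivityLine.densityLLNTrunc_holds η) htyp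

/-- **DISP_h^typ ⟹ MARG_h**: the residual of record rests on the typical-fibre displacement statement alone.
[folklore] -/
theorem horizonCellCountAffinity_of_typ (η : ℝ≥0) (htyp : GroundStateHorizonDisplacementTyp η) :
    GroundStateHorizonCellCountAffinity η :=
  CoercivityLine.horizonCellCountAffinity_of_displacement' η (horizonDisplacement_of_typ' η htyp)

/-- The kernel through the typical-fibre displacement door:
UGS → LOC_h(η) → DISP_h^typ(η) → CSUF_h(η) → SUF_h(η) → `BoseEinsteinCondensation`. [folklore] -/
theorem bec_of_displacementTyp (η : ℝ≥0) (hU : BoxGroundStateUniqueness)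
    (hloc : GroundStateHorizonCondensation η) (htyp : GroundStateHorizonDisplacementTyp η)
    (hcsuf : GroundStateHorizonCellCountSufficiency η) (hsuf : GroundStateHorizonCountSufficiency η) :
    _root_.BoseEinsteinCondensation :=
  CoercivityLine.bec_of_displacement₃ η hU hloc (horizonDisplacement_of_typ' η htyp) hcsuf hsuf

end Summit.AtomisticToContinuum.BoseEinsteinCondensation.Theorems.BoxCountShadow

end
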